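import Summits.FinalStateConjecture.FinalStateConjecture.Theorems.KerrShieldedDataExist.Negative.BentSliceConormal
import Mathlib.Analysis.Calculus.Deriv.MeanValue
import HarnessLib

/-!
# `KerrShieldedDataExist`, line `plug-the-second-sheet` — the bridge annulus, V: the blended profile, zone by
# zone

Support file (everything proved; elementary real analysis only) for stub `stub_bridgeAnnulus` of crux
`stmt-FinalStateConjecture-10055`. The bridge profile is assembled from component functions by smooth
partitions of unity,
`ϱ = (1 − ν)((1 − χ)ρI + χ ϱc) + ν·id`, `τ = T ∘ ϱ + (1 − ν₂)(51M/20 − s − ϱc) + ν₂ (τh ∘ ϱ)`;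
on each of five overlapping open zones some of the weights are `0` or `1` and `(ϱ, τ)` reduce to closed
forms. The lemmas `zoneN_eq` / `zoneN_hasDerivAt` (`N = 1…5`) take the components as ARBITRARY functions
constrained only on the zone at hand and return the closed forms, their derivatives (by local agreement on
the open zone, `HasDerivAt.congr_of_eventuallyEq`) and the elementary bounds used by the spacelike
criterion. [folklore]
-/

-- the doubled `FinalStateConjecture` path component is the summit/problem naming scheme, not a mistake
set_option linter.dupNamespace false

noncomputable section

open Real Set Filter
open scoped Manifold ContDiff Topology InnerProductSpace
open Literature.Geometry.Lorentzian

namespace Summit.FinalStateConjecture.FinalStateConjecture.Theorems.SwallowTheDatum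

namespace Bridge

/-! ### The blended profile, zone by zone

The bridge profile is assembled from component functions by smooth partitions of unity,
`ϱ = (1 − ν)((1 − χ)ρI + χ ϱc) + ν·id`, `τ = T ∘ ϱ + (1 − ν₂)(51M/20 − s − ϱc) + ν₂ (τh ∘ ϱ)`;
on each of five overlapping open zones some of the weights are `0` or `1` and `(ϱ, τ)` reduce to closed
forms whose derivatives and spacelike criterion are elementary. The lemmas of this section take the
components as arbitrary functions constrained only on the zone at hand. -/

section Blend

variable {M ℓ₀ : ℝ} {ρI χ ν ν₂ ϱc τh T ϱ τ : ℝ → ℝ} {Z : Set ℝ}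

/-- **Zone 1 (inner rim, Boyer–Lindquist leaf read through the isotropic map).** Where `χ = ν = ν₂ = 0` and
`ϱc = ℓ₀ − s`: `ϱ = ρI`, `τ = T ∘ ρI + c` with `c = 51M/20 − ℓ₀`. [folklore] -/
theorem zone1_eq (hϱ : ∀ s, ϱ s = (1 - ν s) * ((1 - χ s) * ρI s + χ s * ϱc s) + ν s * s)
    (hτ : ∀ s, τ s = T (ϱ s) + (1 - ν₂ s) * (51 * M / 20 - s - ϱc s) + ν₂ s * τh (ϱ s))
    (hχ : ∀ s ∈ Z, χ s = 0) (hν : ∀ s ∈ Z, ν s = 0) (hν₂ : ∀ s ∈ Z, ν₂ s = 0)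
    (hc : ∀ s ∈ Z, ϱc s = ℓ₀ - s) {s : ℝ} (hs : s ∈ Z) :
    ϱ s = ρI s ∧ τ s = T (ρI s) + (51 * M / 20 - ℓ₀) := by
  have h1 : ϱ s = ρI s := by rw [hϱ, hχ s hs, hν s hs]; ring
  refine ⟨h1, ?_⟩
  rw [hτ, h1, hν₂ s hs, hc s hs]; ring

/-- Zone 1, derivatives: `ϱ′ = ρI′`, `τ′ = T′(ρI) ρI′` (local agreement on the open zone). [folklore] -/
theorem zone1_hasDerivAt (hZ : IsOpen Z)
    (hϱ : ∀ s, ϱ s = (1 - ν s) * ((1 - χ s) * ρI s + χ s * ϱc s) + ν s * s)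
    (hτ : ∀ s, τ s = T (ϱ s) + (1 - ν₂ s) * (51 * M / 20 - s - ϱc s) + ν₂ s * τh (ϱ s))
    (hχ : ∀ s ∈ Z, χ s = 0) (hν : ∀ s ∈ Z, ν s = 0) (hν₂ : ∀ s ∈ Z, ν₂ s = 0)
    (hc : ∀ s ∈ Z, ϱc s = ℓ₀ - s) {s e p : ℝ} (hs : s ∈ Z) (hρI : HasDerivAt ρI e s)
    (hT : HasDerivAt T p (ρI s)) :
    HasDerivAt ϱ e s ∧ HasDerivAt τ (p * e) s := by
  have hev : ∀ᶠ t in 𝓝 s, t ∈ Z := hZ.mem_nhds hs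
  have h1 : ϱ =ᶠ[𝓝 s] ρI := hev.mono fun t ht ↦ (zone1_eq hϱ hτ hχ hν hν₂ hc ht).1
  have h2 : τ =ᶠ[𝓝 s] fun t ↦ T (ρI t) + (51 * M / 20 - ℓ₀) :=
    hev.mono fun t ht ↦ (zone1_eq hϱ hτ hχ hν hν₂ hc ht).2
  exact ⟨hρI.congr_of_eventuallyEq h1, ((hT.comp s hρI).add_const _).congr_of_eventuallyEq h2⟩

/-- **Zone 2 (descent to the corner along the left Kerr–Schild slice).** Where `ν = ν₂ = 0`,
`ϱc = ℓ₀ − s`, `χ ∈ [0, 1]`, `ρI, ℓ₀ ≤ 4M` and `T` vanishes on `(−∞, 4M]`: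
`ϱ = (1 − χ)ρI + χ(ℓ₀ − s)` and `τ = c` is constant. [folklore] -/
theorem zone2_eq (hϱ : ∀ s, ϱ s = (1 - ν s) * ((1 - χ s) * ρI s + χ s * ϱc s) + ν s * s)
    (hτ : ∀ s, τ s = T (ϱ s) + (1 - ν₂ s) * (51 * M / 20 - s - ϱc s) + ν₂ s * τh (ϱ s))
    (hν : ∀ s ∈ Z, ν s = 0) (hν₂ : ∀ s ∈ Z, ν₂ s = 0) (hc : ∀ s ∈ Z, ϱc s = ℓ₀ - s)
    (hχ0 : ∀ s, 0 ≤ χ s) (hχ1 : ∀ s, χ s ≤ 1) (hρI4 : ∀ s ∈ Z, ρI s ≤ 4 * M) (hℓ4 : ℓ₀ ≤ 4 * M)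
    (hZ0 : ∀ s ∈ Z, 0 ≤ s) (hT4 : ∀ r, r ≤ 4 * M → T r = 0) {s : ℝ} (hs : s ∈ Z) :
    ϱ s = (1 - χ s) * ρI s + χ s * (ℓ₀ - s) ∧ ϱ s ≤ 4 * M ∧ τ s = 51 * M / 20 - ℓ₀ := by
  have h1 : ϱ s = (1 - χ s) * ρI s + χ s * (ℓ₀ - s) := by rw [hϱ, hν s hs, hc s hs]; ring
  have h4 : ϱ s ≤ 4 * M := by
    rw [h1]
    have := hχ0 s; have := hχ1 s; have := hρI4 s hs; have := hZ0 s hs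
    nlinarith
  refine ⟨h1, h4, ?_⟩
  rw [hτ, hT4 _ h4, hν₂ s hs, hc s hs]; ring

/-- Zone 2, derivatives: `ϱ′ = (1 − χ)ρI′ − χ + χ′(ℓ₀ − s − ρI)` and `τ′ = 0`. [folklore] -/
theorem zone2_hasDerivAt (hZ : IsOpen Z)
    (hϱ : ∀ s, ϱ s = (1 - ν s) * ((1 - χ s) * ρI s + χ s * ϱc s) + ν s * s)
    (hτ : ∀ s, τ s = T (ϱ s) + (1 - ν₂ s) * (51 * M / 20 - s - ϱc s) + ν₂ s * τh (ϱ s))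
    (hν : ∀ s ∈ Z, ν s = 0) (hν₂ : ∀ s ∈ Z, ν₂ s = 0) (hc : ∀ s ∈ Z, ϱc s = ℓ₀ - s)
    (hχ0 : ∀ s, 0 ≤ χ s) (hχ1 : ∀ s, χ s ≤ 1) (hρI4 : ∀ s ∈ Z, ρI s ≤ 4 * M) (hℓ4 : ℓ₀ ≤ 4 * M)
    (hZ0 : ∀ s ∈ Z, 0 ≤ s) (hT4 : ∀ r, r ≤ 4 * M → T r = 0) {s e x : ℝ} (hs : s ∈ Z)
    (hρI : HasDerivAt ρI e s) (hχd : HasDerivAt χ x s) :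
    HasDerivAt ϱ ((1 - χ s) * e - χ s + x * (ℓ₀ - s - ρI s)) s ∧ HasDerivAt τ 0 s := by
  have hev : ∀ᶠ t in 𝓝 s, t ∈ Z := hZ.mem_nhds hs
  have h1 : ϱ =ᶠ[𝓝 s] fun t ↦ (1 - χ t) * ρI t + χ t * (ℓ₀ - t) :=
    hev.mono fun t ht ↦ (zone2_eq hϱ hτ hν hν₂ hc hχ0 hχ1 hρI4 hℓ4 hZ0 hT4 ht).1
  have h2 : τ =ᶠ[𝓝 s] fun _ ↦ 51 * M / 20 - ℓ₀ :=
    hev.mono fun t ht ↦ (zone2_eq hϱ hτ hν hν₂ hc hχ0 hχ1 hρI4 hℓ4 hZ0 hT4 ht).2.2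
  refine ⟨HasDerivAt.congr_of_eventuallyEq ?_ h1, (hasDerivAt_const s _).congr_of_eventuallyEq h2⟩
  have hd := ((hχd.const_sub 1).fun_mul hρI).fun_add (hχd.fun_mul ((hasDerivAt_id' s).const_sub ℓ₀))
  convert hd using 1
  ring

/-- Zone 2, the radial slope does not vanish: `(1 − χ)ρI′ − χ + χ′(ℓ₀ − s − ρI) < 0` for `ρI′ < 0`,
`χ ∈ [0, 1]`, `χ′ ≥ 0`, `ℓ₀ − s ≤ ρI`. [folklore] -/
theorem zone2_slope_neg {c e x r s : ℝ} (he : e < 0) (hc0 : 0 ≤ c) (hc1 : c ≤ 1) (hx : 0 ≤ x)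
    (hr : ℓ₀ - s ≤ r) : (1 - c) * e - c + x * (ℓ₀ - s - r) < 0 := by
  have h3 : x * (ℓ₀ - s - r) ≤ 0 := mul_nonpos_of_nonneg_of_nonpos hx (by linarith)
  rcases eq_or_lt_of_le hc0 with h | h
  · rw [← h]; linarith
  · nlinarith

/-- **Zone 3 (the corner).** Where `χ = 1`, `ν = ν₂ = 0` and `T(ϱc) = 0`: `ϱ = ϱc`, `τ = 51M/20 − s − ϱc`
(`t* + r = const − s`). [folklore] -/
theorem zone3_eq (hϱ : ∀ s, ϱ s = (1 - ν s) * ((1 - χ s) * ρI s + χ s * ϱc s) + ν s * s)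
    (hτ : ∀ s, τ s = T (ϱ s) + (1 - ν₂ s) * (51 * M / 20 - s - ϱc s) + ν₂ s * τh (ϱ s))
    (hχ : ∀ s ∈ Z, χ s = 1) (hν : ∀ s ∈ Z, ν s = 0) (hν₂ : ∀ s ∈ Z, ν₂ s = 0)
    (hT0 : ∀ s ∈ Z, T (ϱc s) = 0) {s : ℝ} (hs : s ∈ Z) :
    ϱ s = ϱc s ∧ τ s = 51 * M / 20 - s - ϱc s := by
  have h1 : ϱ s = ϱc s := by rw [hϱ, hχ s hs, hν s hs]; ring
  refine ⟨h1, ?_⟩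
  rw [hτ, h1, hT0 s hs, hν₂ s hs]; ring

/-- Zone 3, derivatives: `ϱ′ = ϱc′`, `τ′ = −1 − ϱc′`. [folklore] -/
theorem zone3_hasDerivAt (hZ : IsOpen Z)
    (hϱ : ∀ s, ϱ s = (1 - ν s) * ((1 - χ s) * ρI s + χ s * ϱc s) + ν s * s)
    (hτ : ∀ s, τ s = T (ϱ s) + (1 - ν₂ s) * (51 * M / 20 - s - ϱc s) + ν₂ s * τh (ϱ s))
    (hχ : ∀ s ∈ Z, χ s = 1) (hν : ∀ s ∈ Z, ν s = 0) (hν₂ : ∀ s ∈ Z, ν₂ s = 0)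
    (hT0 : ∀ s ∈ Z, T (ϱc s) = 0) {s e : ℝ} (hs : s ∈ Z) (hcd : HasDerivAt ϱc e s) :
    HasDerivAt ϱ e s ∧ HasDerivAt τ (-1 - e) s := by
  have hev : ∀ᶠ t in 𝓝 s, t ∈ Z := hZ.mem_nhds hs
  have h1 : ϱ =ᶠ[𝓝 s] ϱc := hev.mono fun t ht ↦ (zone3_eq hϱ hτ hχ hν hν₂ hT0 ht).1
  have h2 : τ =ᶠ[𝓝 s] fun t ↦ 51 * M / 20 - t - ϱc t :=
    hev.mono fun t ht ↦ (zone3_eq hϱ hτ hχ hν hν₂ hT0 ht).2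
  refine ⟨hcd.congr_of_eventuallyEq h1, HasDerivAt.congr_of_eventuallyEq ?_ h2⟩
  exact ((hasDerivAt_id' s).const_sub (51 * M / 20)).fun_sub hcd

/-- **Zone 4 (leaving the corner on the straight segment).** Where `χ = 1`, `ν = 0`, `ϱc = 9M/40 + s/2`,
`T(ϱc) = 0` and `τh(ϱc) = 3(M − ϱc)`: `ϱ = 9M/40 + s/2` and `τ = 93M/40 − 3s/2`, whatever the value of the
switch `ν₂` (both formulas for `τ` agree on the segment). [folklore] -/
theorem zone4_eq (hϱ : ∀ s, ϱ s = (1 - ν s) * ((1 - χ s) * ρI s + χ s * ϱc s) + ν s * s)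
    (hτ : ∀ s, τ s = T (ϱ s) + (1 - ν₂ s) * (51 * M / 20 - s - ϱc s) + ν₂ s * τh (ϱ s))
    (hχ : ∀ s ∈ Z, χ s = 1) (hν : ∀ s ∈ Z, ν s = 0) (hc : ∀ s ∈ Z, ϱc s = 9 * M / 40 + s / 2)
    (hT0 : ∀ s ∈ Z, T (9 * M / 40 + s / 2) = 0) (hτh : ∀ s ∈ Z, τh (9 * M / 40 + s / 2) = 3 * (M - (9 * M / 40 + s / 2)))
    {s : ℝ} (hs : s ∈ Z) :
    ϱ s = 9 * M / 40 + s / 2 ∧ τ s = 93 * M / 40 - 3 / 2 * s := by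
  have h1 : ϱ s = 9 * M / 40 + s / 2 := by rw [hϱ, hχ s hs, hν s hs, hc s hs]; ring
  refine ⟨h1, ?_⟩
  rw [hτ, h1, hT0 s hs, hτh s hs, hc s hs]; ring

/-- Zone 4, derivatives: `ϱ′ = 1/2`, `τ′ = −3/2`. [folklore] -/
theorem zone4_hasDerivAt (hZ : IsOpen Z)
    (hϱ : ∀ s, ϱ s = (1 - ν s) * ((1 - χ s) * ρI s + χ s * ϱc s) + ν s * s)
    (hτ : ∀ s, τ s = T (ϱ s) + (1 - ν₂ s) * (51 * M / 20 - s - ϱc s) + ν₂ s * τh (ϱ s))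
    (hχ : ∀ s ∈ Z, χ s = 1) (hν : ∀ s ∈ Z, ν s = 0) (hc : ∀ s ∈ Z, ϱc s = 9 * M / 40 + s / 2)
    (hT0 : ∀ s ∈ Z, T (9 * M / 40 + s / 2) = 0) (hτh : ∀ s ∈ Z, τh (9 * M / 40 + s / 2) = 3 * (M - (9 * M / 40 + s / 2)))
    {s : ℝ} (hs : s ∈ Z) : HasDerivAt ϱ (1 / 2) s ∧ HasDerivAt τ (-(3 / 2)) s := by
  have hev : ∀ᶠ t in 𝓝 s, t ∈ Z := hZ.mem_nhds hs
  have h1 : ϱ =ᶠ[𝓝 s] fun t ↦ 9 * M / 40 + t / 2 :=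
    hev.mono fun t ht ↦ (zone4_eq hϱ hτ hχ hν hc hT0 hτh ht).1
  have h2 : τ =ᶠ[𝓝 s] fun t ↦ 93 * M / 40 - 3 / 2 * t :=
    hev.mono fun t ht ↦ (zone4_eq hϱ hτ hχ hν hc hT0 hτh ht).2
  refine ⟨HasDerivAt.congr_of_eventuallyEq ?_ h1, HasDerivAt.congr_of_eventuallyEq ?_ h2⟩
  · exact ((hasDerivAt_id' s).div_const (2 : ℝ)).const_add (9 * M / 40)
  · have h := ((hasDerivAt_id' s).const_mul (3 / 2 : ℝ)).const_sub (93 * M / 40)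
    rw [mul_one] at h
    exact h

/-- **Zone 5 (outer part: reparametrised ascent onto the Kerr–Schild graph).** Where `χ = ν₂ = 1`,
`ϱc = 9M/40 + s/2` and `T(ϱ) = 0`: `ϱ = (1 − ν)(9M/40 + s/2) + ν s` and `τ = τh ∘ ϱ`. [folklore] -/
theorem zone5_eq (hϱ : ∀ s, ϱ s = (1 - ν s) * ((1 - χ s) * ρI s + χ s * ϱc s) + ν s * s)
    (hτ : ∀ s, τ s = T (ϱ s) + (1 - ν₂ s) * (51 * M / 20 - s - ϱc s) + ν₂ s * τh (ϱ s))
    (hχ : ∀ s ∈ Z, χ s = 1) (hν₂ : ∀ s ∈ Z, ν₂ s = 1) (hc : ∀ s ∈ Z, ϱc s = 9 * M / 40 + s / 2)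
    (hν0 : ∀ s, 0 ≤ ν s) (hν1 : ∀ s, ν s ≤ 1) (hZ : ∀ s ∈ Z, 9 * M / 20 < s ∧ s ≤ 4 * M)
    (hT4 : ∀ r, r ≤ 4 * M → T r = 0) {s : ℝ} (hs : s ∈ Z) :
    ϱ s = (1 - ν s) * (9 * M / 40 + s / 2) + ν s * s ∧ (9 * M / 40 + s / 2 ≤ ϱ s ∧ ϱ s ≤ s) ∧
      τ s = τh (ϱ s) := by
  have h1 : ϱ s = (1 - ν s) * (9 * M / 40 + s / 2) + ν s * s := by rw [hϱ, hχ s hs, hc s hs]; ring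
  have hb : 9 * M / 40 + s / 2 ≤ ϱ s ∧ ϱ s ≤ s := by
    rw [h1]
    have := hν0 s; have := hν1 s; have := (hZ s hs).1
    constructor <;> nlinarith
  refine ⟨h1, hb, ?_⟩
  rw [hτ, hT4 _ (hb.2.trans (hZ s hs).2), hν₂ s hs]; ring

/-- Zone 5, derivatives: `ϱ′ = (1 − ν)/2 + ν + ν′(s/2 − 9M/40) ≥ 1/2` and `τ′ = τh′(ϱ) ϱ′`. [folklore] -/
theorem zone5_hasDerivAt (hZo : IsOpen Z)
    (hϱ : ∀ s, ϱ s = (1 - ν s) * ((1 - χ s) * ρI s + χ s * ϱc s) + ν s * s)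
    (hτ : ∀ s, τ s = T (ϱ s) + (1 - ν₂ s) * (51 * M / 20 - s - ϱc s) + ν₂ s * τh (ϱ s))
    (hχ : ∀ s ∈ Z, χ s = 1) (hν₂ : ∀ s ∈ Z, ν₂ s = 1) (hc : ∀ s ∈ Z, ϱc s = 9 * M / 40 + s / 2)
    (hν0 : ∀ s, 0 ≤ ν s) (hν1 : ∀ s, ν s ≤ 1) (hZ : ∀ s ∈ Z, 9 * M / 20 < s ∧ s ≤ 4 * M)
    (hT4 : ∀ r, r ≤ 4 * M → T r = 0) {s x p : ℝ} (hs : s ∈ Z) (hνd : HasDerivAt ν x s) (hx : 0 ≤ x)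
    (hτh : HasDerivAt τh p (ϱ s)) :
    HasDerivAt ϱ ((1 - ν s) / 2 + ν s + x * (s / 2 - 9 * M / 40)) s ∧
      1 / 2 ≤ (1 - ν s) / 2 + ν s + x * (s / 2 - 9 * M / 40) ∧
      HasDerivAt τ (p * ((1 - ν s) / 2 + ν s + x * (s / 2 - 9 * M / 40))) s := by
  have hev : ∀ᶠ t in 𝓝 s, t ∈ Z := hZo.mem_nhds hs
  have h1 : ϱ =ᶠ[𝓝 s] fun t ↦ (1 - ν t) * (9 * M / 40 + t / 2) + ν t * t :=
    hev.mono fun t ht ↦ (zone5_eq hϱ hτ hχ hν₂ hc hν0 hν1 hZ hT4 ht).1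
  have h2 : τ =ᶠ[𝓝 s] fun t ↦ τh (ϱ t) :=
    hev.mono fun t ht ↦ (zone5_eq hϱ hτ hχ hν₂ hc hν0 hν1 hZ hT4 ht).2.2
  have hd : HasDerivAt ϱ ((1 - ν s) / 2 + ν s + x * (s / 2 - 9 * M / 40)) s := by
    refine HasDerivAt.congr_of_eventuallyEq ?_ h1
    have ha : HasDerivAt (fun t : ℝ ↦ 9 * M / 40 + t / 2) (1 / 2) s :=
      ((hasDerivAt_id' s).div_const (2 : ℝ)).const_add (9 * M / 40)
    have h := ((hνd.const_sub 1).fun_mul ha).fun_add (hνd.fun_mul (hasDerivAt_id' s))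
    convert h using 1
    ring
  refine ⟨hd, ?_, (hτh.comp s hd).congr_of_eventuallyEq h2⟩
  have := hν0 s; have := hν1 s; have := (hZ s hs).1
  nlinarith [mul_nonneg hx (show 0 ≤ s / 2 - 9 * M / 40 by linarith)]

end Blend

end Bridge

/-- **Registered export of this file** (sub-goal `bridge_zoneOne` of stub `stub_bridgeAnnulus`): the inner zone of the blended profile in closed form, `Bridge.zone1_eq`. [folklore] -/
theorem bridge_zoneOne :
    ∀ (M ℓ₀ : ℝ) (ρI χ ν ν₂ ϱc τh T ϱ τ : ℝ → ℝ) (Z : Set ℝ), (∀ s, ϱ s = (1 - ν s) * ((1 - χ s) * ρI s + χ s * ϱc s) + ν s * s) → (∀ s, τ s = T (ϱ s) + (1 - ν₂ s) * (51 * M / 20 - s - ϱc s) + ν₂ s * τh (ϱ s)) → (∀ s ∈ Z, χ s = 0) → (∀ s ∈ Z, ν s = 0) → (∀ s ∈ Z, ν₂ s = 0) → (∀ s ∈ Z, ϱc s = ℓ₀ - s) → ∀ s ∈ Z, ϱ s = ρI s ∧ τ s = T (ρI s) + (51 * M / 20 - ℓ₀) :=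
  fun _ _ _ _ _ _ _ _ _ _ _ _ hϱ hτ hχ hν hν₂ hc _ hs ↦ Bridge.zone1_eq hϱ hτ hχ hν hν₂ hc hs

end Summit.FinalStateConjecture.FinalStateConjecture.Theorems.SwallowTheDatum

end
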